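import Summits.ValiantsHypothesis.ValiantsHypothesis.Theses.DivisionGap

/-!
# `ZeroOneTransfer` — negative lemma: the kill criterion via Valiant's planar matching family

Crux `stmt-ValiantsHypothesis-5066` (`Theses.DivisionGap.ZeroOneTransfer`, route DivisionGap).
Standing disprover (cdisprove), `Cruxes/ZeroOneTransfer/Disproof.lean` §(C).

* `coeff_sum_prod_X_graph` — a "graph polynomial" `Σ_{f ∈ S} Π_v X (v, f v)` (any finite set
  `S` of maps `f : α → β`, variables indexed by `α × β`) has coefficients in `{0, 1}` over every
  commutative semiring: distinct maps have distinct monomials.  This covers the perfect-matching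
  polynomials of cruxes `TriangularDimersDivisionEasy` / `SquareGridDimersDivisionEasy`
  (fixed-point-free adjacent involutions) and the arborescence sum of `StDivisionEasy`.
* `map_sum_prod_X_graph` — such polynomials are compatible with every change of scalars.
* `zeroOneTransfer_false_of_triangularDimers_hard` — the route's kill criterion made formal:
  if the complexification of the triangular-lattice dimer family `D_n` is in `VP_ℂ` (Kasteleyn's
  Pfaffian orientation / FKT, Valiant 1980 Thm 2 — NOT in the tree, entered as a hypothesis) and
  `TriangularDimersDivisionEasy` fails, then `ZeroOneTransfer` fails.  So a refutation of crux 4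
  is one Kasteleyn formalisation away from `¬ ZeroOneTransfer`.
[cite: Valiant1980, §3 Thm. 2] [cite: FominGrigorievKoshevoy2014, Remark 1.5]
-/

namespace Summit.ValiantsHypothesis.ValiantsHypothesis.Theorems.ZeroOneTransfer.Negative

open Literature.Computability.AlgebraicComplexity MvPolynomial
open scoped NNReal
open Summit.ValiantsHypothesis.ValiantsHypothesis.Theses.DivisionGap
  (ZeroOneTransfer TriangularDimersDivisionEasy)

noncomputable section

/-- Exponent vector of the monomial `Π_v X (v, f v)` at `(a, b)`: `1` if `f a = b`, else `0`.
[folklore] -/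
theorem sum_single_graph_apply {α β : Type*} [Fintype α] [DecidableEq α] [DecidableEq β]
    (f : α → β) (a : α) (b : β) :
    (∑ v : α, Finsupp.single (v, f v) (1 : ℕ)) (a, b) = if f a = b then 1 else 0 := by
  rw [Finsupp.coe_finsetSum, Finset.sum_apply, Finset.sum_eq_single a]
  · by_cases h : f a = b
    · simp [h]
    · rw [if_neg h, Finsupp.single_apply, if_neg]
      intro hab; exact h (Prod.ext_iff.mp hab).2
  · intro v _ hv
    rw [Finsupp.single_apply, if_neg]
    intro hab; exact hv (Prod.ext_iff.mp hab).1
  · intro ha; exact absurd (Finset.mem_univ a) ha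

/-- Distinct maps have distinct graph monomials. [folklore] -/
theorem sum_single_graph_injective {α β : Type*} [Fintype α] [DecidableEq α] [DecidableEq β] :
    Function.Injective fun f : α → β => ∑ v : α, Finsupp.single (v, f v) (1 : ℕ) := by
  intro f g hfg
  funext a
  have h := congrArg (fun e => e (a, f a)) hfg
  simp only [sum_single_graph_apply, ite_true] at h
  by_cases hg : g a = f a
  · exact hg.symm
  · rw [if_neg hg] at h; exact absurd h one_ne_zero

/-- The graph monomial as a `monomial`. [folklore] -/
theorem prod_X_graph_eq_monomial {α β : Type*} [Fintype α] [DecidableEq α] [DecidableEq β]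
    (R : Type*) [CommSemiring R] (f : α → β) :
    ∏ v : α, (X (v, f v) : MvPolynomial (α × β) R) =
      monomial (∑ v : α, Finsupp.single (v, f v) (1 : ℕ)) 1 := by
  rw [monomial_sum_one]
  rfl

/-- **Graph polynomials have 0/1 coefficients.**  For every finite set `S` of maps `α → β`,
every coefficient of `Σ_{f ∈ S} Π_v X (v, f v)` is `0` or `1`. [folklore] -/
theorem coeff_sum_prod_X_graph {α β : Type*} [Fintype α] [DecidableEq α] [DecidableEq β]
    (R : Type*) [CommSemiring R] (S : Finset (α → β)) (m : (α × β) →₀ ℕ) :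
    coeff m (∑ f ∈ S, ∏ v : α, (X (v, f v) : MvPolynomial (α × β) R)) = 0 ∨
      coeff m (∑ f ∈ S, ∏ v : α, (X (v, f v) : MvPolynomial (α × β) R)) = 1 := by
  classical
  simp_rw [prod_X_graph_eq_monomial R]
  rw [coeff_sum]
  simp only [coeff_monomial]
  rw [Finset.sum_boole]
  have hcard : (S.filter fun f : α → β =>
      (∑ v : α, Finsupp.single (v, f v) (1 : ℕ)) = m).card ≤ 1 := by
    refine Finset.card_le_one.mpr ?_
    intro f hf g hg
    simp only [Finset.mem_filter] at hf hg
    exact sum_single_graph_injective (hf.2.trans hg.2.symm)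
  rcases Nat.le_one_iff_eq_zero_or_eq_one.mp hcard with h0 | h1
  · left; simp [h0]
  · right; simp [h1]

/-- Graph polynomials are compatible with change of scalars. [folklore] -/
theorem map_sum_prod_X_graph {α β : Type*} [Fintype α] {R S' : Type*} [CommSemiring R]
    [CommSemiring S'] (φ : R →+* S') (S : Finset (α → β)) :
    map φ (∑ f ∈ S, ∏ v : α, (X (v, f v) : MvPolynomial (α × β) R)) =
      ∑ f ∈ S, ∏ v : α, (X (v, f v) : MvPolynomial (α × β) S') := by
  simp only [_root_.map_sum, _root_.map_prod, map_X]

/-- **Kill criterion, formally.**  If the complexified triangular-lattice dimer family (the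
polynomial of crux `TriangularDimersDivisionEasy`, mapped along `ℝ≥0 → ℝ → ℂ`) is in `VP_ℂ` —
Kasteleyn's theorem, entered as the hypothesis `hVP` — and `TriangularDimersDivisionEasy` fails,
then `ZeroOneTransfer` fails: the dimer family has 0/1 coefficients (`coeff_sum_prod_X_graph`) and
the crux's conclusion for it is literally `TriangularDimersDivisionEasy`.
[cite: Valiant1980, §3 Thm. 2] [cite: FominGrigorievKoshevoy2014, Remark 1.5] -/
theorem zeroOneTransfer_false_of_triangularDimers_hard
    (hVP : IsVPFamily (k := ℂ) fun n => MvPolynomial.map (Complex.ofRealHom.comp NNReal.toRealHom)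
      (∑ f ∈ (Finset.univ : Finset (Fin n × Fin n → Fin n × Fin n)).filter (fun f => ∀ v, f (f v) = v ∧ f v ≠ v ∧ (((v.1 : ℕ) + 1 = (f v).1 ∧ (v.2 : ℕ) = (f v).2) ∨ (((f v).1 : ℕ) + 1 = v.1 ∧ (v.2 : ℕ) = (f v).2) ∨ ((v.1 : ℕ) = (f v).1 ∧ (v.2 : ℕ) + 1 = (f v).2) ∨ ((v.1 : ℕ) = (f v).1 ∧ ((f v).2 : ℕ) + 1 = v.2) ∨ ((v.1 : ℕ) + 1 = (f v).1 ∧ ((f v).2 : ℕ) + 1 = v.2) ∨ (((f v).1 : ℕ) + 1 = v.1 ∧ (v.2 : ℕ) + 1 = (f v).2))), ∏ v : Fin n × Fin n, (MvPolynomial.X (v, f v) : MvPolynomial ((Fin n × Fin n) × (Fin n × Fin n)) NNReal)))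
    (hhard : ¬ TriangularDimersDivisionEasy) : ¬ ZeroOneTransfer := by
  intro H
  apply hhard
  classical
  exact H (fun n => (Fin n × Fin n) × (Fin n × Fin n)) _
    (fun n m => by convert coeff_sum_prod_X_graph ℝ≥0 _ m) hVP

end

end Summit.ValiantsHypothesis.ValiantsHypothesis.Theorems.ZeroOneTransfer.Negative
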